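import Summits.HodgeConjecture.HodgeCM.Literature.ThetaCorrespondence_3

/-! PORT of `HodgeCM/Literature/ThetaCorrespondence.lean` (HodgeCMPerL run 81) — part 4: continuation of `Summits.HodgeConjecture.HodgeCM.Literature.ThetaCorrespondence_3` (split at a top-level declaration boundary by port_pkg.py; scope re-opened below; declarations unchanged). -/

-- port_pkg: scope re-opened for this part (file-level context, then the namespace/section stack open at the cut)
set_option autoImplicit false
noncomputable section
open scoped TensorProduct
universe u
namespace HodgeCM.Literature.Theta
local notation "⟪" x ", " y "⟫" => @inner ℂ _ _ x y
namespace Li92GlobalDatum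
variable (D : Li92GlobalDatum.{u})
/-- **Stable range ⇒ every local representation lifts (J.-S. Li).**  AS PRINTED [Li92, **Theorem 5.4** (see
[18], [19]), p. 206]: "a) If the dual pair `(G(k_v), G'(k_v))` is in the stable range then `H(π_v)` is non-zero
for any `π_v` and affords an irreducible unitary representation of `G̃(k_v)`.  b) If `n ≥ n'` and `π_v` is a
discrete series representation then either `H(π_v)` is zero or it affords an irreducible representation of
`G̃(k_v)`.  In either case a) or b) above, the representation of `G̃(k_v)` on `H(π_v)` is the one which
corresponds to `π_v*` via Howe's local duality correspondence.  Moreover if `H(π_v) = 0` in b) then `π_v` do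
not occur in Howe's correspondence."  ([18] = [Li89] J.-S. Li, Invent. Math. 97 (1989) 237–255; [19] = [Li90].)
Followed by (p. 206): "The condition `n > 2n' + 4ε − 2` guarantees that `(G(k_v), G'(k_v))` is in the stable
range for each *non-archimedean* `v`."
TYPING: conjunct 1 = a) (with its irreducibility / Howe-correspondent clause folded into `occIrr`); conjunct 2
= the displayed sentence (archimedean places = `arch`).  b) is not typed (PerL's `G'(k_v) = U(1)` is compact at
the archimedean places, where occurrence is decided by PerL Lemma 4.1 instead).
PerL v5 USE: Lemma 4.2(b) proof, LOCAL OCCURRENCE at the finite places, tex ll. 544–547 (node N31a) — PerL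
argues via the conservation relation (§3 `ConservationRelation.firstOcc_le_three`) and, at split `v`, type II
(§10); Li's a) is the stable-range route (§4 `StableRangeOccurrence` typed it from [SZ15]'s paraphrase of
[Li89]; this is Li's own printed form): for `(U(V₃), U(W_i))` at a finite `v` of `L₀`, `V₃ ⊗ L_v` is a Hermitian
3-space over a `p`-adic quadratic extension, hence isotropic (PerL l. 577–578), Witt index `1 ≥ dim W_i = 1`;
at split `v`, `(GL₃, GL₁)` with `3 ≥ 2·1`.  MISMATCH: none (the dictionary items of §9 apply). -/
def StableRangeLocal : Prop :=
  (∀ (v : D.Pl) (πv : D.Irr v), D.stable v → D.occ v πv ∧ D.occIrr v πv) ∧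
  (D.convergentRange → ∀ v : D.Pl, v ∉ D.arch → D.stable v)

/-- **Global non-vanishing and irreducibility of the theta lift in the stable range (J.-S. Li).**  AS PRINTED
[Li92, **Corollary 5.5**, p. 206]: "Suppose `n > 2n' + 4ε − 2`.  Let `S_∞ ⊆ S` be the set of archimedean places
of `k`.  Assume that `π_v` is a discrete series representation for each `v ∈ S_∞`.  Then `V(θ, π) ≠ 0` if and
only if `H(π_v) ≠ 0` for each `v ∈ S_∞`.  In that case it affords an irreducible unitary representation of
`G̃(𝔸)`.  Write `σ = ⊗ σ_v` for this representation.  Then for every place `v` we have `σ_v → π_v*` under Howe's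
correspondence."  (Proof printed pp. 204–206: Thm 2.1, the Euler product (52) `⟨θ^{f₁}_{φ₁}, θ^{f₂}_{φ₂}⟩ =
I_S(φ₁,φ₂,f₁,f₂) · L^S(π, γ^G, s₀ + ½)/d^S_H(s₀)` with `L^S(…) ≠ 0` (Lemma 5.3), and Thm 5.4.)
TYPING: conjunct 1 = the "if and only if"; conjunct 2 = "in that case … irreducible … `σ_v → π_v*` for every
place `v`".  Li's standing assumption p. 204 ("everything is unramified outside `S`", `S ⊇ S_∞` finite) is part
of the meaning of `Cusp` (every cusp form `⊗ π_v` is unramified outside a finite set).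
PerL v5 USE — this is the PRINT form of the conclusion of **Lemma 4.2(b)** (tex ll. 529–532, node N31: "`π_i :=
Θ^{W_i}_{μ_i}(χ'_i) ≠ 0` and every irreducible constituent of its closure lies in `𝒜^{1,0}`") and of its proof's
last two steps (ll. 608–635, nodes N31h (i) non-vanishing, N31h (ii) constituents): with `(G, G') = (U(V₃),
U(W_i))`, `(n, n', ε) = (3, 1, ½)`, `π = χ'_i` (every character of the COMPACT group `U(W_i)(L_{0,b}) = U(1)`,
`b` archimedean, is a discrete series representation), Cor. 5.5 gives: `Θ(χ'_i) ≠ 0` **iff** `χ'_{i,b}` occurs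
in `ω_b` at every archimedean `b` — which is PerL Lemma 4.1(a)/(c) (tex ll. 480–482, 496–511; nodes N27/N29:
occurrence at `b` iff `χ'_{i,b}(u) = u^{e_b(Ψ_i)}`, decided on the Fock model) — and THEN the closure of
`Θ(χ'_i)` is IRREDUCIBLE (stronger than PerL needs) with component at each archimedean `b` the Howe
correspondent of `(χ'_{i,b})*`, i.e. (PerL Lemma 4.1) `J⁺` at `ι₁` and the trivial-type representation at the
definite `b`, so it lies in `𝒜^{1,0}` (PerL l. 622–623) and `Φ'(σ) = Ψ_i` (Lemma 3.3(a), node N12); at the finite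
places the components are the local theta lifts (PerL l. 93 / l. 289–295, node N12's unramified line).  Kernel
form: `nonzero_irreducible_of_arch`, `occ_everywhere` below.
MISMATCH / DICTIONARY (GAPS.md cfKHRg2-N1): (i) metaplectic-genuine `π` on `G̃'(𝔸)` vs PerL's character `χ'_i`
of `U(W_i)` with the `(χ_V, μ_i)`-splitting (as §9 (i)); (ii) Li's Howe correspondent is that of the
CONTRAGREDIENT `π_v*` — a sign convention the Fock-model dictionary (LEMMAS.md D5; PerL Lemma 4.1's exponents
`e_b(Ψ_i)`) must track; (iii) `V(θ, π)` uses all of `S(X(𝔸))` whereas PerL's `Θ^{W_i}_{μ_i}(χ'_i)` uses the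
`K_∞`-finite (Fock-polynomial) Schwartz space `𝒮` — the two spans have the same closure (density, PerL tex
ll. 341–349, node N18), so "`≠ 0`" agrees; (iv) irreducibility is MORE than PerL claims (PerL Remark 3.8: "Not
used: … irreducibility of any theta lift") — harmless. -/
def StableRangeNonvanishing : Prop :=
  D.convergentRange →
    ∀ π : D.Cusp, (∀ v ∈ D.arch, D.ds v (D.loc π v)) →
      (D.thetaNe π ↔ ∀ v ∈ D.arch, D.occ v (D.loc π v)) ∧
      (D.thetaNe π → D.thetaIrr π ∧ ∀ v : D.Pl, D.howe π v)

/-- PerL's instance of the range: `(n, n', d, d₀) = (3, 1, 2, 1)`. -/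
example : (2 * 1 : ℚ) + 4 * (1 : ℚ) / 2 - 2 < 3 := by norm_num

variable {D}

/-- **PerL Lemma 4.2(b) from print, kernel-checked:** in Li's range, a cusp form with discrete-series
archimedean components that OCCUR at every archimedean place has a NON-ZERO global theta lift, which is
IRREDUCIBLE with local components the Howe correspondents at every place (Cor. 5.5). -/
theorem StableRangeNonvanishing.nonzero_irreducible_of_arch (h : D.StableRangeNonvanishing)
    (hcr : D.convergentRange) {π : D.Cusp} (hds : ∀ v ∈ D.arch, D.ds v (D.loc π v))
    (hocc : ∀ v ∈ D.arch, D.occ v (D.loc π v)) :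
    D.thetaNe π ∧ D.thetaIrr π ∧ ∀ v : D.Pl, D.howe π v := by
  obtain ⟨hiff, hthen⟩ := h hcr π hds
  have hne : D.thetaNe π := hiff.mpr hocc
  exact ⟨hne, hthen hne⟩

/-- **Converse direction, kernel-checked** (the "only if" of Cor. 5.5): a non-zero global lift forces
occurrence at every archimedean place (PerL Lemma 4.1(a), first sentence: "`θ(φ, χ'_i) ≠ 0` with archimedean
components … ⇒ `χ'_{i,b}(u) = u^{e_b(Ψ_i)}` for all `b`", node N27, is PerL's own form of this). -/
theorem StableRangeNonvanishing.occ_arch_of_nonzero (h : D.StableRangeNonvanishing)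
    (hcr : D.convergentRange) {π : D.Cusp} (hds : ∀ v ∈ D.arch, D.ds v (D.loc π v)) (hne : D.thetaNe π) :
    ∀ v ∈ D.arch, D.occ v (D.loc π v) :=
  (h hcr π hds).1.mp hne

/-- **Local occurrence everywhere, kernel-checked** (PerL l. 542–547, node N31a, all places at once): in Li's
range the finite places are in the stable range (Thm 5.4 + the displayed sentence), so `H(π_v) ≠ 0` there for
ANY `π_v`; with occurrence at the archimedean places assumed, every local lift exists. -/
theorem StableRangeLocal.occ_everywhere (hloc : D.StableRangeLocal) (hcr : D.convergentRange) {π : D.Cusp}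
    (hocc : ∀ v ∈ D.arch, D.occ v (D.loc π v)) (v : D.Pl) : D.occ v (D.loc π v) := by
  by_cases hv : v ∈ D.arch
  · exact hocc v hv
  · exact (hloc.1 v (D.loc π v) (hloc.2 hcr v hv)).1

end Li92GlobalDatum

end HodgeCM.Literature.Theta

end
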